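import Literature.MathematicalPhysics.QuantumFieldTheory.Balaban1983to89.B9Eq326DeltaALocalityZdSides
import Literature.MathematicalPhysics.QuantumFieldTheory.Balaban1983to89.B9Thm311PerMemberCubeZdUnconditional
import Literature.MathematicalPhysics.QuantumFieldTheory.Balaban1983to89.B8LayerAxialGauge

/-!
# `Balaban1983to89.B9Thm311PerMemberCubeZdTouching` — [Balaban1985BackgroundPropagators] Thm 3.11 p. 416 AT ONE CUBE MEMBER, IN THE CURRENCY OF
# [Balaban1985RegularSpaces] (1.7) p. 77: EVERY unitary background whose PLAQUETTES TOUCHING `□₀` are `α`-close to `1` — the level-`0` clause of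
# `U₀ ∈ 𝔄_m({□_j}, α₀)` (`B8Ineq132.InAk`), the class of the junction's DATUM — has `G_𝔤(U₀) = (□₀Δ_a(U₀)□₀)⁻¹` and `Δ_a(U₀) > 0` on `E_𝔤(□₀)`
# for the genuine four-letter `Δ_a` at print's class; unconditional, `α` member-dependent

statement-level skeleton of published theorems with citation tags; proofs where landed; nothing here is a claim about the
Yang–Mills mass gap

T. Bałaban, *Propagators for lattice gauge theories in a background field*, Commun. Math. Phys. **99** (1985) 389–434 [`Balaban1985BackgroundPropagators`,
"B9"], journal page = PDF page + 388: Thm 3.11 p. 416 («Under the assumptions of the Theorems 3.1–3.10 … the operators Δ′_a, G′, (Q′G′²Q′*)⁻¹, Δ_a, G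
are positive definite», and its proof «Doing the gauge transformation we get the configuration U = e^{iηA} with A small, and by (3.86) …»), (3.27) p. 395
(`G(U) = (Ω₀Δ_aΩ₀)⁻¹`), (3.26) p. 395 (`Δ_a`), (3.34)–(3.36) p. 396 (gauge covariance).  [`Balaban1985RegularSpaces`, "B8", CMP **99** (1985) 75–102]
p. 77 (the class `𝔄_k({Ω_j}, α₀)`: «|U(∂p) − 1| < α₀L^{−2j} for p ∈ Ω_j», with «we denote by Ω also the set of bonds … Similarly for the corresponding set
of plaquettes» — the TOUCHING convention), Lemma 1 p. 79 (the axial gauge), (1.58) p. 86, (1.131) p. 99 (the cube member).  [`Balaban1985Averaging`,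
"B7"] p. 24 (the axial gauge estimate «|V₀(x, x + e₂) − 1| < |x₁ − y₁|α₀»).

CITATION HEADER ∕ WHY THIS FILE (cell `pub-ymgap`, HUMAN RULING D-0062; seat `pub-ymgap-dag-n06-b` (g20), node N06 = [B9]; binder owner of the junction
J-N06→N05).  g19's `B9Thm311PerMemberCubeZdUnconditional` concluded Theorem 3.11 per member for backgrounds with small plaquette variables on the BOX
`□₀ ± 3` (`pdevOn`).  The junction's datum is a background of [B8]'s class `𝔄_m({□_j}, α₀)` — its level-`0` clause bounds the plaquettes TOUCHING `□₀`
and nothing farther out —, and the frame's class (3.35) (`bgZd.Reg335`, cubes inside `□₀`) cannot see the collar at all (LOCATED-SELF-6 of this seat).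
THIS FILE moves the per-member theorem to the datum's currency: with the sharp locality `B9Eq326DeltaALocalityZdSides.regular_opsAllZd_congr_cube_sides`
(this seat, g20: the genuine `Δ_a(U₀)↾E(□₀)` reads `U₀` only on the SIDES of the plaquettes touching `□₀`) as the (L) input, dag-n05-w3 g3's LAYER AXIAL
GAUGE `B8LayerAxialGauge.exists_layerGauge` (Lemma 1's axial gauge + the clamping gauge: `|U^u(b) − 1| ≤ (|□|₁ + 1)·α` on every side of every plaquette
touching `□` from `|U(∂p) − 1| ≤ α` for the touching plaquettes ONLY) replaces [B7]'s global axial gauge of g19's `B9Thm311GaugeReductionZd`, and the (B)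
«uniform ball» (dag-n06-w4 g3 + dag-n06-w2 g3) and (G) «gauge orbit» (dag-n06-w3 g3) inputs are consumed BY NAME exactly as in g19's PART B.

WHAT IS PROVED (kernel, 0 sorry, 0 def; no `instance`, no `notation`).
* §1 ★★ `of_touching_plaquettes_unitary` — THE TRANSFER SCHEMA IN THE UNITARY CURRENCY: (B) `P` on a uniform ball of unitary backgrounds, (G) `P V → P(V^u)`
  for unitary `u, V`, (L) `P` reads only the sides of the plaquettes touching the box `[lo, hi]` ⟹ `∃ α > 0`, every unitary `U` whose touching plaquettes
  are `α`-close to `1` has `P` (the gauge of `exists_layerGauge` is unitary-valued, so unitary covariance suffices); `sqLo_le_sqHi_zero`, `plaqTouches_mono`.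
* §2 ★★★ `regularAtH_of_plaqTouches_cube` — at a cube member (`Ω = cubeFam false L a Mc ρ k`, `Λs = cubeLamS …`, `m ≤ k`, `2 ≤ d`, `2 ≤ L ≤ ρ`), class
  `cubeLamBP`, faithful Hermitian tracial `τ`: `∃ α > 0`, every unitary `U₀` with `‖U₀(∂p) − 1‖ ≤ α` for the plaquettes `p` TOUCHING `□₀` has
  `RegularAtH i.η (opsAllZd τ L (cubeLamBP …) ops₀ M i m) (i.Ω 0) U₀ ∧ Reg17 L m i.Ω (α_Q∕L²) U₀`; ★★★ `posDefH_of_plaqTouches_cube`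
  (`0 < ⟨A, Δ_a(U₀)A⟩_τ` on `E_𝔤(□₀) ∖ 0`); ★★ `gopZdH_deltaAOf_of_plaqTouches_cube` ((3.27) as (1.58) uses it).
* §3 THE DATUM'S CURRENCY: ★★★ `regularAtH_of_inAk_cube` ∕ ★★★ `posDefH_of_inAk_cube` ∕ ★★ `gopZdH_deltaAOf_of_inAk_cube` — `∃ α > 0, ∀ α₀ ≤ α`, every
  unitary `U₀ ∈ 𝔄_m({□_j}, α₀)` (`InAk L m i.η α₀ i.Ω U₀`) has the three conclusions.  Non-vacuous: `U₀ = 1 ∈ 𝔄_m(α₀)` for every `α₀ > 0`.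

HONEST SCOPE.  By-name composition of landed per-member inputs with a kinematic gauge schema; `α` is EXISTENTIAL and MEMBER-DEPENDENT (compactness ∕
continuity), NOT print's uniform `α₀′, M₀` of Thm 3.11 (which rest on Thm 3.3's decay and the partition (3.115)); no bound on `G_𝔤(U₀)`; nothing of
Thm 3.3; count-neutral helper of K1⁷ (`--supports stmt-QuantumFields-20542`); N05∕N06 NOT discharged; one finite `𝕋⁴` programme at fixed `ε`, Bałaban as
printed; R4 closes only the conditional finite-`𝕋⁴` rung `BalabanLadder.UV` — nothing continuum ∕ `ℝ⁴` ∕ OS ∕ mass gap ∕ Clay.  Unit `pub-ymgap-dag-n06-b`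
(g20), 2026-08-28.
-/

noncomputable section

open scoped BigOperators

namespace Literature.MathematicalPhysics.QuantumFieldTheory.Balaban1983to89.B9Thm311PerMemberCubeZdTouching

open B7Prop1Explicit (e gaugeAct l1 U1)
open B7Prop1Local (InBox)
open B7Prop2Explicit (unitaryUnits unitaryUnits_le_U1)
open B8Ineq132 (PlaqTouches BondTouches plaqF InAk CondAt)
open B8Eq140Level (SideTouches)
open B8Eq131Cubes (cube sqLo sqHi cube_anti bLo bHi gs one_le_gs)
open B8Eq131CubesAdmissible (cubeFam cubeFam_false_of_le cubeFam_false_zero)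
open B8CubeMemberZd (cubeLamS)
open B8Ineq159FlatCubeMemberPrinted (cubeLamBP)
open B8Ineq159FlatCubeMemberKernel (mem_cube_zero_iff)
open B8LeafModelZd (ZdIdx)
open B8Eq115GaugeFixing (gaugeAct_mem_of)
open B8LayerAxialGauge (exists_layerGauge)
open B9SupplySockB9P3ZdLetters (OpsZd deltaAOf)
open B9SupplySockB9P3ZdLettersOmega (omega_subset_of_le)
open B9Eq327GreenZd (domSub bondPair)
open B9Eq327GreenZdHerm (domSubH RegularAtH gopZdH gopZdH_apply_eq_of_regularAtH)
open B9Eq333ProjectionCovarianceZd (gaugeAct_inv_gaugeAct inv_mem_unitaryUnits)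
open B9Eq334GaugeCovarianceZd (gaugeAct_mem_unitaryUnits')
open B9SupplySockB9P3ZdAllLettersZd (opsAllZd)
open B9Eq316AveragingTransposeZd (Reg17 alphaQ alphaQ_pos)
open B9Eq316AveragingTransposeZdLevelZero (hbox0_cubeLamBP_of_eq)
open B9Eq326DeltaALocalityZdSides (regular_opsAllZd_congr_cube_sides)

export B7Prop1Explicit (Site)

variable {d : ℕ} {𝔸 : Type*} [CStarAlgebra 𝔸] [Nontrivial 𝔸]

/-! ## §1 The transfer schema in the unitary currency -/

section Schema

/-- ★★ **THE LAYER-GAUGE TRANSFER SCHEMA FOR UNITARY BACKGROUNDS** (the twin of `B8LayerAxialGauge.of_touching_plaquettes` with (B) and (G) separated and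
stated for unitary gauges): for a property `P` of bond fields such that (B) `P V` for every unitary `V` uniformly `δ`-close to `1`, (G) `P V → P(V^u)` for
unitary `u`, `V`, and (L) `P` reads only the sides of the plaquettes touching the box `[lo, hi]` (among unitary fields), EVERY unitary `U` whose plaquettes
touching the box are `α`-close to `1` has `P`, for some `α > 0` depending on `δ` and the box (`α = δ ∕ (2(|hi − lo|₁ + 1))`).  Mechanism: the layer gauge
`u` of `exists_layerGauge` (unitary-valued, from `U`) makes `U^u` `δ∕2`-close to `1` on those sides; cut `U^u` off to `1` elsewhere (still unitary), apply
(B), transfer back by (L), undo the gauge by (G) at `u⁻¹`. [cite: Balaban1985RegularSpaces, Lemma 1 p.79, (1.11) p.78, p.77; Balaban1985Averaging, p.24; Balaban1985BackgroundPropagators, Thm 3.11 p.416 (the gauge step of its proof)] -/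
theorem of_touching_plaquettes_unitary {lo hi : Site d} (hlohi : ∀ i, lo i ≤ hi i) {P : (Site d → Fin d → 𝔸ˣ) → Prop}
    (hB : ∃ δ : ℝ, 0 < δ ∧ ∀ V : Site d → Fin d → 𝔸ˣ, (∀ x κ, V x κ ∈ unitaryUnits 𝔸) →
      (∀ x κ, ‖((V x κ : 𝔸ˣ) : 𝔸) - 1‖ < δ) → P V)
    (hG : ∀ (u : Site d → 𝔸ˣ) (V : Site d → Fin d → 𝔸ˣ), (∀ x, u x ∈ unitaryUnits 𝔸) → (∀ x κ, V x κ ∈ unitaryUnits 𝔸) →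
      P V → P (gaugeAct u V))
    (hL : ∀ (U U' : Site d → Fin d → 𝔸ˣ), (∀ x κ, U x κ ∈ unitaryUnits 𝔸) → (∀ x κ, U' x κ ∈ unitaryUnits 𝔸) →
      (∀ (y : Site d) (τ : Fin d), SideTouches {z | InBox lo hi z} y τ → U y τ = U' y τ) → P U → P U') :
    ∃ α : ℝ, 0 < α ∧ ∀ U : Site d → Fin d → 𝔸ˣ, (∀ x κ, U x κ ∈ unitaryUnits 𝔸) →
      (∀ (z : Site d) (κ μ : Fin d), κ ≠ μ → PlaqTouches {y | InBox lo hi y} z κ μ → ‖plaqF U κ μ z - 1‖ ≤ α) → P U := by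
  classical
  obtain ⟨δ, hδ, hBall⟩ := hB
  have hN : (0 : ℝ) < (l1 (hi - lo) : ℝ) + 1 := by positivity
  refine ⟨δ / 2 / ((l1 (hi - lo) : ℝ) + 1), by positivity, fun U hU hP => ?_⟩
  have hU1 : ∀ x κ, U x κ ∈ U1 𝔸 := fun x κ => unitaryUnits_le_U1 (hU x κ)
  obtain ⟨u, huH, -, hclose⟩ := exists_layerGauge hU1 hU hlohi (by positivity) hP
  have hδ' : ((l1 (hi - lo) : ℝ) + 1) * (δ / 2 / ((l1 (hi - lo) : ℝ) + 1)) = δ / 2 := by field_simp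
  -- the cut-off of `U^u` to the sides of the touching plaquettes
  obtain ⟨V, hV⟩ : ∃ V : Site d → Fin d → 𝔸ˣ,
      V = fun x κ => if SideTouches {z | InBox lo hi z} x κ then gaugeAct u U x κ else 1 := ⟨_, rfl⟩
  have hVH : ∀ x κ, V x κ ∈ unitaryUnits 𝔸 := by
    intro x κ; rw [hV]; dsimp only; split_ifs
    · exact gaugeAct_mem_of hU huH x κ
    · exact (unitaryUnits 𝔸).one_mem
  have hVδ : ∀ x κ, ‖((V x κ : 𝔸ˣ) : 𝔸) - 1‖ < δ := by
    intro x κ; rw [hV]; dsimp only; split_ifs with hst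
    · have h := hclose x κ hst
      rw [hδ'] at h
      linarith
    · rw [Units.val_one, sub_self, norm_zero]; exact hδ
  have hPV : P V := hBall V hVH hVδ
  have huU : ∀ x κ, gaugeAct u U x κ ∈ unitaryUnits 𝔸 := fun x κ => gaugeAct_mem_of hU huH x κ
  have hPuU : P (gaugeAct u U) := hL V (gaugeAct u U) hVH huU (fun y τ hst => by rw [hV]; exact if_pos hst) hPV
  have h := hG u⁻¹ (gaugeAct u U) (inv_mem_unitaryUnits huH) huU hPuU
  rwa [gaugeAct_inv_gaugeAct] at h

omit [CStarAlgebra 𝔸] [Nontrivial 𝔸] in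
/-- `sqLo₀ ≤ sqHi₀` for the cube member (`ρ ≥ 1`; `gs ≥ 1`). [cite: Balaban1985RegularSpaces, (1.131) p.99 (bookkeeping)] -/
theorem sqLo_le_sqHi_zero (L : ℕ) (a : Site d) (Mc : ℕ) {ρ : ℕ} (hρ : 1 ≤ ρ) (k : ℕ) : ∀ i', sqLo L a ρ k 0 i' ≤ sqHi L a Mc ρ k 0 i' := by
  intro i'
  simp only [sqLo, sqHi, B8Eq131Cubes.bLo, B8Eq131Cubes.bHi]
  have h1 : (0 : ℤ) ≤ (L : ℤ) ^ (k - 0) * (Mc : ℤ) := by positivity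
  have h2 : (1 : ℤ) ≤ ((ρ * gs L (k - 0) : ℕ) : ℤ) := by
    have := one_le_gs L (k - 0)
    have : 1 ≤ ρ * gs L (k - 0) := Nat.le_trans (by omega) (Nat.mul_le_mul hρ this)
    exact_mod_cast this
  nlinarith

omit [CStarAlgebra 𝔸] [Nontrivial 𝔸] in
/-- a plaquette touching a subset touches the set. [cite: Balaban1985RegularSpaces, p.77 (touching convention)] -/
theorem plaqTouches_mono {S T : Set (Site d)} (hST : S ⊆ T) {z : Site d} {κ μ : Fin d} (h : PlaqTouches S z κ μ) : PlaqTouches T z κ μ := by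
  rcases h with h | h | h | h
  exacts [Or.inl (hST h), Or.inr (Or.inl (hST h)), Or.inr (Or.inr (Or.inl (hST h))), Or.inr (Or.inr (Or.inr (hST h)))]

omit [Nontrivial 𝔸] in
/-- the level-`0` clause of `U₀ ∈ 𝔄_m({Ω_j}, α₀)`: every plaquette touching `Ω₀` is `α₀`-close to `1`. [cite: Balaban1985RegularSpaces, (1.7) p.77] -/
theorem plaq_le_of_inAk {L m : ℕ} {η α₀ : ℝ} {Ω : ℕ → Set (Site d)} {U₀ : Site d → Fin d → 𝔸ˣ} (h : InAk L m η α₀ Ω U₀)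
    (z : Site d) (κ μ : Fin d) (hκμ : κ ≠ μ) (hpt : PlaqTouches (Ω 0) z κ μ) : ‖plaqF U₀ κ μ z - 1‖ ≤ α₀ := by
  have h0 := (h 0 (Nat.zero_le m)).1 z κ μ hκμ hpt
  simp only [pow_zero, inv_one, one_pow, mul_one] at h0
  exact h0.le

end Schema

/-! ## §2 Theorem 3.11 at the cube member from the touching plaquettes -/

section Touching

variable (τ : 𝔸 →ₗ[ℂ] ℂ) [FiniteDimensional ℝ 𝔸] {L : ℕ}
  (hτp : ∀ a : 𝔸, a ≠ 0 → 0 < (τ (star a * a)).re) (hτt : ∀ a b : 𝔸, τ (a * b) = τ (b * a))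
  (hτs : ∀ a : 𝔸, τ (star a) = starRingEnd ℂ (τ a))

include hτp hτt hτs in
/-- ★★★ **[B9] THEOREM 3.11 AT ONE CUBE MEMBER FROM THE LEVEL-0 CLAUSE OF (1.7).**  At a cube member of [Balaban1985RegularSpaces] (1.131) (`Ω = cubeFam false
L a Mc ρ k`, `Λs = cubeLamS …`, every truncation `m ≤ k`, `2 ≤ d`, `2 ≤ L ≤ ρ`), for print's constraint class `cubeLamBP` and a faithful Hermitian tracial
`τ` on a finite-dimensional fibre, THERE IS `α > 0` (depending on the member) such that EVERY unitary background `U₀` with `‖U₀(∂p) − 1‖ ≤ α` for the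
plaquettes `p` TOUCHING `□₀` (p. 77's «p ∈ Ω₀») has `G_𝔤(U₀) = (□₀Δ_a(U₀)□₀)⁻¹` (`RegularAtH`) for the genuine four-letter `Δ_a(U₀) = D*D + Δ′(U₀) +
D R(U₀) 𝟙 D* + Q*aQ(U₀)`, and lies in print's class (1.7) of the member at the window `α_Q∕L²` (so `Q*aQ` is print's operator there).  PROOF: (B) flat
positivity ⟹ regularity on a uniform ball (dag-n06-w4 g3 `regularAtH_eventually_one_cube_reg17UnivP`, dag-n06-w2 g3 `exists_uniform_ball_…`), (G) along
unitary gauge orbits (dag-n06-w3 g3 `regularAtH_opsAllZd_gaugeAct_iff`), (L) the sides locality of this seat (`regular_opsAllZd_congr_cube_sides`), assembled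
by `of_touching_plaquettes_unitary` with dag-n05-w3 g3's layer gauge; the (1.7) certificate by shrinking `α` below `(α_Q∕L²)L^{−2m}`.
[cite: Balaban1985BackgroundPropagators, Thm 3.11 p.416, (3.27) p.395, (3.34)–(3.36) p.396; Balaban1985RegularSpaces, (1.7) p.77, Lemma 1 p.79, (1.131) p.99] -/
theorem regularAtH_of_plaqTouches_cube (hd2 : 2 ≤ d) (hL : 2 ≤ L) (ops₀ : ℝ → ZdIdx d L → ℕ → OpsZd d 𝔸) (M : ℝ) (i : ZdIdx d L)
    {a : Site d} {Mc ρ : ℕ} (hρ : L ≤ ρ) (hΩ : i.Ω = cubeFam false L a Mc ρ i.k) (hΛs : i.Λs = cubeLamS L a Mc ρ i.k) {m : ℕ} (hm : m ≤ i.k) :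
    ∃ α : ℝ, 0 < α ∧ ∀ U₀ : Site d → Fin d → 𝔸ˣ, (∀ x κ, U₀ x κ ∈ unitaryUnits 𝔸) →
      (∀ (z : Site d) (κ μ : Fin d), κ ≠ μ → PlaqTouches (i.Ω 0) z κ μ → ‖plaqF U₀ κ μ z - 1‖ ≤ α) →
        RegularAtH i.η (opsAllZd τ L (cubeLamBP L a Mc ρ i.k) ops₀ M i m) (i.Ω 0) U₀ ∧
          Reg17 L m i.Ω (alphaQ d L / (L : ℝ) ^ 2) U₀ := by
  haveI : NeZero L := ⟨by omega⟩
  have hL1 : 1 ≤ L := le_trans (by norm_num) hL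
  have hfin : (i.Ω 0).Finite := B9Thm311PosDefOpenZd.cubeMember_Ω0_finite i hΩ
  have hset : {y : Site d | InBox (sqLo L a ρ i.k 0) (sqHi L a Mc ρ i.k 0) y} = i.Ω 0 := by
    rw [hΩ, cubeFam_false_zero]; ext y; exact (mem_cube_zero_iff L a Mc ρ i.k y).symm
  -- (B): regularity ∀ᶠ within the (1.7)-on-ℤᵈ regime at the flat background, read on a uniform ball
  have hev := B9Thm311PosDefNearFlatZd.regularAtH_eventually_one_cube_reg17UnivP (τ := τ) (hτp := hτp) (hτt := hτt) (hτs := hτs)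
    hd2 hL ops₀ M i hΩ hΛs hρ hm
  have hball := B9Eq17RegimeBallZd.exists_uniform_ball_of_eventually_reg17UnivP (𝔸 := 𝔸) hL1 m hev
  -- (G): regularity passes along unitary gauge orbits (P₀ box clause at print's class)
  have hbox := hbox0_cubeLamBP_of_eq hL1 i a Mc hρ hΩ hm
  have hcov : ∀ (u : Site d → 𝔸ˣ) (U : Site d → Fin d → 𝔸ˣ), (∀ x, u x ∈ unitaryUnits 𝔸) → (∀ x κ, U x κ ∈ unitaryUnits 𝔸) →
      RegularAtH i.η (opsAllZd τ L (cubeLamBP L a Mc ρ i.k) ops₀ M i m) (i.Ω 0) U →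
        RegularAtH i.η (opsAllZd τ L (cubeLamBP L a Mc ρ i.k) ops₀ M i m) (i.Ω 0) (gaugeAct u U) :=
    fun u U hu hU h => (B9Eq334GaugeCovarianceZdHerm.regularAtH_opsAllZd_gaugeAct_iff τ L (cubeLamBP L a Mc ρ i.k) ops₀ M i m hL
      hbox hτt hτs hτp hU hu hfin).mpr h
  -- (L): the sides locality
  have hloc : ∀ (U U' : Site d → Fin d → 𝔸ˣ), (∀ x κ, U x κ ∈ unitaryUnits 𝔸) → (∀ x κ, U' x κ ∈ unitaryUnits 𝔸) →
      (∀ (y : Site d) (τ' : Fin d), SideTouches {z | InBox (sqLo L a ρ i.k 0) (sqHi L a Mc ρ i.k 0) z} y τ' → U y τ' = U' y τ') →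
      RegularAtH i.η (opsAllZd τ L (cubeLamBP L a Mc ρ i.k) ops₀ M i m) (i.Ω 0) U →
        RegularAtH i.η (opsAllZd τ L (cubeLamBP L a Mc ρ i.k) ops₀ M i m) (i.Ω 0) U' := by
    intro U U' _ _ hag hP
    rw [hset] at hag
    exact ((regular_opsAllZd_congr_cube_sides τ hd2 hL ops₀ M i hρ hΩ hΛs hfin hm hag).1).mp hP
  obtain ⟨α, hα, hmain⟩ := of_touching_plaquettes_unitary (sqLo_le_sqHi_zero L a Mc (le_trans hL1 hρ) i.k) hball hcov hloc
  -- the (1.7) certificate: shrink `α` below `(α_Q∕L²)·L^{−2m}`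
  have hQ : 0 < alphaQ d L / (L : ℝ) ^ 2 := div_pos (alphaQ_pos d hL1) (by positivity)
  obtain ⟨β, hβ_def⟩ : ∃ β : ℝ, β = alphaQ d L / (L : ℝ) ^ 2 * (((L : ℝ) ^ m)⁻¹) ^ 2 / 2 := ⟨_, rfl⟩
  have hβ : 0 < β := by rw [hβ_def]; positivity
  refine ⟨min α β, lt_min hα hβ, fun U₀ hU₀ hsmall => ⟨?_, fun j hj z μ ν hμν hpt => ?_⟩⟩
  · exact hmain U₀ hU₀ fun z κ μ hκμ hpt => (hsmall z κ μ hκμ (by rw [hset] at hpt; exact hpt)).trans (min_le_left _ _)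
  · -- a plaquette touching `□_j ⊂ □₀`
    have hpt0 : PlaqTouches (i.Ω 0) z μ ν := plaqTouches_mono (omega_subset_of_le i (Nat.zero_le j)) hpt
    have h1 := (hsmall z μ ν hμν hpt0).trans (min_le_right _ _)
    have hLr : (1 : ℝ) ≤ (L : ℝ) := by exact_mod_cast hL1
    have hpow : ((L : ℝ) ^ m)⁻¹ ≤ ((L : ℝ) ^ j)⁻¹ := by
      apply inv_anti₀ (by positivity)
      exact pow_le_pow_right₀ hLr hj
    have hpow0 : 0 ≤ ((L : ℝ) ^ m)⁻¹ := by positivity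
    have hsq : (((L : ℝ) ^ m)⁻¹) ^ 2 ≤ (((L : ℝ) ^ j)⁻¹) ^ 2 := pow_le_pow_left₀ hpow0 hpow 2
    have hpos : 0 < alphaQ d L / (L : ℝ) ^ 2 * (((L : ℝ) ^ j)⁻¹) ^ 2 := by positivity
    calc ‖plaqF U₀ μ ν z - 1‖ ≤ β := h1
      _ = alphaQ d L / (L : ℝ) ^ 2 * (((L : ℝ) ^ m)⁻¹) ^ 2 / 2 := hβ_def
      _ ≤ alphaQ d L / (L : ℝ) ^ 2 * (((L : ℝ) ^ j)⁻¹) ^ 2 / 2 := by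
          apply div_le_div_of_nonneg_right _ (by norm_num)
          exact mul_le_mul_of_nonneg_left hsq hQ.le
      _ < alphaQ d L / (L : ℝ) ^ 2 * (((L : ℝ) ^ j)⁻¹) ^ 2 := by linarith

include hτp hτt hτs in
/-- ★★★ **THEOREM 3.11's POSITIVITY ON `E_𝔤(□₀)` FROM THE LEVEL-0 CLAUSE OF (1.7)**: `α > 0` (member-dependent) such that every unitary `U₀` whose plaquettes
touching `□₀` are `α`-close to `1` has `0 < ⟨A, Δ_a(U₀)A⟩_τ` for every Hermitian `0 ≠ A ∈ E(□₀)` — print's «Δ_a … positive definite» at the member.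
[cite: Balaban1985BackgroundPropagators, Thm 3.11 p.416, (3.26) p.395, (3.34)–(3.36) p.396; Balaban1985RegularSpaces, (1.7) p.77, Lemma 1 p.79] -/
theorem posDefH_of_plaqTouches_cube (hd2 : 2 ≤ d) (hL : 2 ≤ L) (ops₀ : ℝ → ZdIdx d L → ℕ → OpsZd d 𝔸) (M : ℝ) (i : ZdIdx d L)
    {a : Site d} {Mc ρ : ℕ} (hρ : L ≤ ρ) (hΩ : i.Ω = cubeFam false L a Mc ρ i.k) (hΛs : i.Λs = cubeLamS L a Mc ρ i.k) {m : ℕ} (hm : m ≤ i.k) :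
    ∃ α : ℝ, 0 < α ∧ ∀ U₀ : Site d → Fin d → 𝔸ˣ, (∀ x κ, U₀ x κ ∈ unitaryUnits 𝔸) →
      (∀ (z : Site d) (κ μ : Fin d), κ ≠ μ → PlaqTouches (i.Ω 0) z κ μ → ‖plaqF U₀ κ μ z - 1‖ ≤ α) →
        ∀ A ∈ domSubH (𝔸 := 𝔸) (i.Ω 0), A ≠ 0 → 0 < bondPair τ A (deltaAOf i.η (opsAllZd τ L (cubeLamBP L a Mc ρ i.k) ops₀ M i m) U₀ A) := by
  haveI : NeZero L := ⟨by omega⟩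
  have hL1 : 1 ≤ L := le_trans (by norm_num) hL
  have hfin : (i.Ω 0).Finite := B9Thm311PosDefOpenZd.cubeMember_Ω0_finite i hΩ
  have hset : {y : Site d | InBox (sqLo L a ρ i.k 0) (sqHi L a Mc ρ i.k 0) y} = i.Ω 0 := by
    rw [hΩ, cubeFam_false_zero]; ext y; exact (mem_cube_zero_iff L a Mc ρ i.k y).symm
  have hev := B9Thm311PosDefNearFlatZd.bondPair_pos_eventually_one_cube_reg17UnivP (τ := τ) (hτp := hτp) (hτt := hτt) (hτs := hτs)
    hd2 hL ops₀ M i hΩ hΛs hρ hm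
  have hball := B9Eq17RegimeBallZd.exists_uniform_ball_of_eventually_reg17UnivP (𝔸 := 𝔸) hL1 m hev
  have hbox := hbox0_cubeLamBP_of_eq hL1 i a Mc hρ hΩ hm
  have hcov : ∀ (u : Site d → 𝔸ˣ) (U : Site d → Fin d → 𝔸ˣ), (∀ x, u x ∈ unitaryUnits 𝔸) → (∀ x κ, U x κ ∈ unitaryUnits 𝔸) →
      (∀ A ∈ domSubH (𝔸 := 𝔸) (i.Ω 0), A ≠ 0 → 0 < bondPair τ A (deltaAOf i.η (opsAllZd τ L (cubeLamBP L a Mc ρ i.k) ops₀ M i m) U A)) →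
        ∀ A ∈ domSubH (𝔸 := 𝔸) (i.Ω 0), A ≠ 0 →
          0 < bondPair τ A (deltaAOf i.η (opsAllZd τ L (cubeLamBP L a Mc ρ i.k) ops₀ M i m) (gaugeAct u U) A) :=
    fun u U hu hU h => B9Eq334GaugeCovarianceZdHerm.posDefH_opsAllZd_gaugeAct τ L (cubeLamBP L a Mc ρ i.k) ops₀ M i m hL hbox
      hτt hτs hτp hU hu hfin h
  have hloc : ∀ (U U' : Site d → Fin d → 𝔸ˣ), (∀ x κ, U x κ ∈ unitaryUnits 𝔸) → (∀ x κ, U' x κ ∈ unitaryUnits 𝔸) →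
      (∀ (y : Site d) (τ' : Fin d), SideTouches {z | InBox (sqLo L a ρ i.k 0) (sqHi L a Mc ρ i.k 0) z} y τ' → U y τ' = U' y τ') →
      (∀ A ∈ domSubH (𝔸 := 𝔸) (i.Ω 0), A ≠ 0 → 0 < bondPair τ A (deltaAOf i.η (opsAllZd τ L (cubeLamBP L a Mc ρ i.k) ops₀ M i m) U A)) →
        ∀ A ∈ domSubH (𝔸 := 𝔸) (i.Ω 0), A ≠ 0 →
          0 < bondPair τ A (deltaAOf i.η (opsAllZd τ L (cubeLamBP L a Mc ρ i.k) ops₀ M i m) U' A) := by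
    intro U U' _ _ hag hP A hA hA0
    rw [hset] at hag
    rw [← (regular_opsAllZd_congr_cube_sides τ hd2 hL ops₀ M i hρ hΩ hΛs hfin hm hag).2.2.2 A (B9Eq327GreenZdHerm.domSubH_le _ hA)]
    exact hP A hA hA0
  obtain ⟨α, hα, hmain⟩ := of_touching_plaquettes_unitary (sqLo_le_sqHi_zero L a Mc (le_trans hL1 hρ) i.k) hball hcov hloc
  exact ⟨α, hα, fun U₀ hU₀ hsmall => hmain U₀ hU₀ fun z κ μ hκμ hpt => hsmall z κ μ hκμ (by rw [hset] at hpt; exact hpt)⟩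

include hτp hτt hτs in
/-- ★★ **(3.27) AS [Balaban1985RegularSpaces] (1.58) USES IT, FROM THE LEVEL-0 CLAUSE OF (1.7)**: `G_𝔤(U₀)J = A` for every Hermitian `A ∈ E(□₀)` and every `J`
agreeing with `Δ_a(U₀)A` on the bonds of `□₀`, at every unitary `U₀` whose plaquettes touching `□₀` are `α`-close to `1` (`α` of `regularAtH_of_plaqTouches_cube`).
[cite: Balaban1985BackgroundPropagators, (3.27) p.395, Thm 3.11 p.416; Balaban1985RegularSpaces, (1.58) p.86, (1.7) p.77] -/
theorem gopZdH_deltaAOf_of_plaqTouches_cube (hd2 : 2 ≤ d) (hL : 2 ≤ L) (ops₀ : ℝ → ZdIdx d L → ℕ → OpsZd d 𝔸) (M : ℝ) (i : ZdIdx d L)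
    {a : Site d} {Mc ρ : ℕ} (hρ : L ≤ ρ) (hΩ : i.Ω = cubeFam false L a Mc ρ i.k) (hΛs : i.Λs = cubeLamS L a Mc ρ i.k) {m : ℕ} (hm : m ≤ i.k) :
    ∃ α : ℝ, 0 < α ∧ ∀ U₀ : Site d → Fin d → 𝔸ˣ, (∀ x κ, U₀ x κ ∈ unitaryUnits 𝔸) →
      (∀ (z : Site d) (κ μ : Fin d), κ ≠ μ → PlaqTouches (i.Ω 0) z κ μ → ‖plaqF U₀ κ μ z - 1‖ ≤ α) →
        ∀ A ∈ domSubH (𝔸 := 𝔸) (i.Ω 0), ∀ J : Site d → Fin d → 𝔸,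
          (∀ (y : Site d) (μ : Fin d), BondTouches (i.Ω 0) y μ → J y μ = deltaAOf i.η (opsAllZd τ L (cubeLamBP L a Mc ρ i.k) ops₀ M i m) U₀ A y μ) →
          gopZdH i.η (opsAllZd τ L (cubeLamBP L a Mc ρ i.k) ops₀ M i m) (i.Ω 0) U₀ J = A := by
  obtain ⟨α, hα, h⟩ := regularAtH_of_plaqTouches_cube τ hτp hτt hτs hd2 hL ops₀ M i hρ hΩ hΛs hm
  exact ⟨α, hα, fun U₀ hU₀ hsmall A hA J hJ => gopZdH_apply_eq_of_regularAtH i.η _ (i.Ω 0) U₀ (h U₀ hU₀ hsmall).1 hA hJ⟩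

end Touching

/-! ## §3 The datum's currency: `U₀ ∈ 𝔄_m({□_j}, α₀)` -/

section Datum

variable (τ : 𝔸 →ₗ[ℂ] ℂ) [FiniteDimensional ℝ 𝔸] {L : ℕ}
  (hτp : ∀ a : 𝔸, a ≠ 0 → 0 < (τ (star a * a)).re) (hτt : ∀ a b : 𝔸, τ (a * b) = τ (b * a))
  (hτs : ∀ a : 𝔸, τ (star a) = starRingEnd ℂ (τ a))

include hτp hτt hτs in
/-- ★★★ **[B9] THEOREM 3.11 AT ONE CUBE MEMBER FOR EVERY DATUM OF THE JUNCTION**: `∃ α > 0` (member-dependent) such that for every `α₀ ≤ α` (no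
positivity of `α₀` needed) and every unitary `U₀ ∈ 𝔄_m({□_j}, α₀)` (`B8Ineq132.InAk L m i.η α₀ i.Ω U₀`, the socket's own hypothesis on
its datum): `RegularAtH` for the genuine four-letter record at print's class and the (1.7) certificate at the window `α_Q∕L²`.
[cite: Balaban1985BackgroundPropagators, Thm 3.11 p.416, (3.27) p.395; Balaban1985RegularSpaces, (1.7) p.77, (1.33) p.82, (1.58) p.86, (1.131) p.99] -/
theorem regularAtH_of_inAk_cube (hd2 : 2 ≤ d) (hL : 2 ≤ L) (ops₀ : ℝ → ZdIdx d L → ℕ → OpsZd d 𝔸) (M : ℝ) (i : ZdIdx d L)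
    {a : Site d} {Mc ρ : ℕ} (hρ : L ≤ ρ) (hΩ : i.Ω = cubeFam false L a Mc ρ i.k) (hΛs : i.Λs = cubeLamS L a Mc ρ i.k) {m : ℕ} (hm : m ≤ i.k) :
    ∃ α : ℝ, 0 < α ∧ ∀ α₀ : ℝ, α₀ ≤ α → ∀ U₀ : Site d → Fin d → 𝔸ˣ, (∀ x κ, U₀ x κ ∈ unitaryUnits 𝔸) →
      InAk L m i.η α₀ i.Ω U₀ →
        RegularAtH i.η (opsAllZd τ L (cubeLamBP L a Mc ρ i.k) ops₀ M i m) (i.Ω 0) U₀ ∧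
          Reg17 L m i.Ω (alphaQ d L / (L : ℝ) ^ 2) U₀ := by
  obtain ⟨α, hα, h⟩ := regularAtH_of_plaqTouches_cube τ hτp hτt hτs hd2 hL ops₀ M i hρ hΩ hΛs hm
  exact ⟨α, hα, fun α₀ hα₀ U₀ hU₀ hIn => h U₀ hU₀ fun z κ μ hκμ hpt => (plaq_le_of_inAk hIn z κ μ hκμ hpt).trans hα₀⟩

include hτp hτt hτs in
/-- ★★★ **THEOREM 3.11's POSITIVITY AT ONE CUBE MEMBER FOR EVERY DATUM OF THE JUNCTION** (`α₀ ≤ α`, `U₀ ∈ 𝔄_m({□_j}, α₀)` unitary ⟹ `0 < ⟨A, Δ_a(U₀)A⟩_τ` on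
`E_𝔤(□₀) ∖ 0`). [cite: Balaban1985BackgroundPropagators, Thm 3.11 p.416, (3.26) p.395; Balaban1985RegularSpaces, (1.7) p.77, (1.131) p.99] -/
theorem posDefH_of_inAk_cube (hd2 : 2 ≤ d) (hL : 2 ≤ L) (ops₀ : ℝ → ZdIdx d L → ℕ → OpsZd d 𝔸) (M : ℝ) (i : ZdIdx d L)
    {a : Site d} {Mc ρ : ℕ} (hρ : L ≤ ρ) (hΩ : i.Ω = cubeFam false L a Mc ρ i.k) (hΛs : i.Λs = cubeLamS L a Mc ρ i.k) {m : ℕ} (hm : m ≤ i.k) :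
    ∃ α : ℝ, 0 < α ∧ ∀ α₀ : ℝ, α₀ ≤ α → ∀ U₀ : Site d → Fin d → 𝔸ˣ, (∀ x κ, U₀ x κ ∈ unitaryUnits 𝔸) →
      InAk L m i.η α₀ i.Ω U₀ →
        ∀ A ∈ domSubH (𝔸 := 𝔸) (i.Ω 0), A ≠ 0 → 0 < bondPair τ A (deltaAOf i.η (opsAllZd τ L (cubeLamBP L a Mc ρ i.k) ops₀ M i m) U₀ A) := by
  obtain ⟨α, hα, h⟩ := posDefH_of_plaqTouches_cube τ hτp hτt hτs hd2 hL ops₀ M i hρ hΩ hΛs hm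
  exact ⟨α, hα, fun α₀ hα₀ U₀ hU₀ hIn => h U₀ hU₀ fun z κ μ hκμ hpt => (plaq_le_of_inAk hIn z κ μ hκμ hpt).trans hα₀⟩

include hτp hτt hτs in
/-- ★★ **(3.27) AS (1.58) USES IT, FOR EVERY DATUM OF THE JUNCTION**: `α₀ ≤ α`, `U₀ ∈ 𝔄_m({□_j}, α₀)` unitary, Hermitian `A ∈ E(□₀)`, `J = Δ_a(U₀)A` on the
bonds of `□₀` ⟹ `G_𝔤(U₀)J = A`. [cite: Balaban1985BackgroundPropagators, (3.27) p.395, Thm 3.11 p.416; Balaban1985RegularSpaces, (1.58) p.86, (1.7) p.77] -/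
theorem gopZdH_deltaAOf_of_inAk_cube (hd2 : 2 ≤ d) (hL : 2 ≤ L) (ops₀ : ℝ → ZdIdx d L → ℕ → OpsZd d 𝔸) (M : ℝ) (i : ZdIdx d L)
    {a : Site d} {Mc ρ : ℕ} (hρ : L ≤ ρ) (hΩ : i.Ω = cubeFam false L a Mc ρ i.k) (hΛs : i.Λs = cubeLamS L a Mc ρ i.k) {m : ℕ} (hm : m ≤ i.k) :
    ∃ α : ℝ, 0 < α ∧ ∀ α₀ : ℝ, α₀ ≤ α → ∀ U₀ : Site d → Fin d → 𝔸ˣ, (∀ x κ, U₀ x κ ∈ unitaryUnits 𝔸) →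
      InAk L m i.η α₀ i.Ω U₀ →
        ∀ A ∈ domSubH (𝔸 := 𝔸) (i.Ω 0), ∀ J : Site d → Fin d → 𝔸,
          (∀ (y : Site d) (μ : Fin d), BondTouches (i.Ω 0) y μ → J y μ = deltaAOf i.η (opsAllZd τ L (cubeLamBP L a Mc ρ i.k) ops₀ M i m) U₀ A y μ) →
          gopZdH i.η (opsAllZd τ L (cubeLamBP L a Mc ρ i.k) ops₀ M i m) (i.Ω 0) U₀ J = A := by
  obtain ⟨α, hα, h⟩ := regularAtH_of_inAk_cube τ hτp hτt hτs hd2 hL ops₀ M i hρ hΩ hΛs hm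
  exact ⟨α, hα, fun α₀ hα₀ U₀ hU₀ hIn A hA J hJ => gopZdH_apply_eq_of_regularAtH i.η _ (i.Ω 0) U₀ (h α₀ hα₀ U₀ hU₀ hIn).1 hA hJ⟩

end Datum

end Literature.MathematicalPhysics.QuantumFieldTheory.Balaban1983to89.B9Thm311PerMemberCubeZdTouching

end
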